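import Literature.NumberTheory.LFunctions.LevinsonMontgomeryTheorem
import Literature.NumberTheory.LFunctions.RiemannSiegelStirling
import Literature.NumberTheory.LFunctions.LagariasXiPositivityEq14Proofs
import Literature.NumberTheory.LFunctions.RiemannXiLogDeriv
import Literature.NumberTheory.LFunctions.ZetaFirstZeroCertificate
import Literature.NumberTheory.LFunctions.ZetaRealAxis
import Literature.NumberTheory.LFunctions.GeneralizedRH
import Literature.NumberTheory.LFunctions.MiscArithmeticRHEquivalents
import Literature.NumberTheory.LFunctions.XiModulusMonotone
import Mathlib.Analysis.InnerProductSpace.Calculus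
import Mathlib.Analysis.Complex.RealDeriv
import HarnessLib

/-!
# RH-FREE / RH-EQUIVALENT — Matiyasevich–Saidak–Zvengrowski 2014: `Re η′/η < Re ζ′/ζ < Re ξ′/ξ` (Thm 1.3, `|t| ≥ 8`), `|η|, |ζ|, |ξ|` strictly decreasing in `σ ≤ 0` for `|t| ≥ 8` (Thm 1.4), PROVED; and «extending this region to `σ ≤ 1/2` is equivalent to RH» PROVED as an equivalence for each of the three functions («nothing here bears on the truth of RH»)

Topic `Literature/NumberTheory/LFunctions` (RH literature-typing tranche 1: Broughan, *Equivalents of the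
Riemann Hypothesis* vol. 1, ch. 10 neighbourhood of "Dixon and Spira" — the size / horizontal behaviour of
`|ζ|` left of the critical line; the `ξ`-form (Sondow–Dumitrescu 2010) is vol. 2 ch. 4 and is HELD in
`XiModulusMonotone.lean`. The volumes are not held, so no theorem number of Broughan's is claimed.)
Yu. Matiyasevich, F. Saidak, P. Zvengrowski, *Horizontal monotonicity of the modulus of the zeta function,
L-functions, and related functions*, Acta Arith. **166** (2014) 189–200 = arXiv:1205.2773, READ
`[corpus: paper:arxiv-1205.2773 p0003 (Thms 1.3, 1.4), p0004 (Lemmas 2.1–2.3, Cor 2.4–2.5), p0006–p0007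
(§3: Lemmas 3.1–3.2, proofs of (A), (B), Thm 3.4)]`. AS PRINTED:

* **Theorem 1.3.** "For `|t| ≥ 8`, `σ < 1/2`, one has
  `Re(η′(s)/η(s)) < Re(ζ′(s)/ζ(s)) < Re(ξ′(s)/ξ(s))`." [cite: MatiyasevichSaidakZvengrowski2014, Thm 1.3]
* **Theorem 1.4** (= Theorem 3.4). "The moduli of all three functions `η(s)`, `ζ(s)`, and `ξ(s)` are monotone
  decreasing with respect to `σ` in the region `σ ≤ 0`, `|t| ≥ 8`. Extending this region to `σ ≤ 1/2`, for
  any of the three functions, is equivalent to the Riemann hypothesis." ("by 'monotone' we always mean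
  monotone with respect to `σ`"; Lemma 2.3: "strictly decreasing with respect to `σ`".)
  [cite: MatiyasevichSaidakZvengrowski2014, Thm 1.4]

Here `ξ(s) := (s−1)Γ(1+s/2)π^{−s/2}ζ(s)` [MSZ §1] `= ½ s(s−1)π^{−s/2}Γ(s/2)ζ(s)` is the tree's `riemannXi`,
and `η(s) = (1 − 2^{1−s})ζ(s)` is Euler's / Dirichlet's eta function, the tree's `dirichletEta`
(`MiscArithmeticRHEquivalents.lean` §D, value `log 2` at the removable point `s = 1`).

## What is proved here (everything printed in Thms 1.3–1.4 and Lemma 3.1; no definition, no named fact)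

* `MatiyasevichSaidakZvengrowski2014.re_digamma_ge_of_four_le_abs_im` — `Re ψ(w) ≥ 1.3048` whenever
  `|Im w| ≥ 4` (all `Re w`; the version of Lemma 3.2 (ii)+(v) that the proof of (B) actually needs, see
  DEVIATION below);
* `lmGammaRe_neg_of_eight_le_abs_im` — the tree's Levinson–Montgomery `Γ`-part
  `M(s) = −Re 1/(s−1) + ½ log π − ½ Re ψ(s/2+1)` (`lmGammaRe`, LM (2.1)) is `< 0` for `|t| ≥ 8`, every `σ`
  (the tree had `M(s) < −1/10` for `σ ≥ 0`, `|t| ≥ 10`, `lmGammaRe_lt_neg`);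
* `MatiyasevichSaidakZvengrowski2014.logDeriv_riemannZeta_eq` — the printed identity
  `ξ′/ξ = ζ′/ζ + 1/(s−1) + ½Ψ(s/2+1) − ½ log π`, i.e. `Re ζ′/ζ(s) = Re ξ′/ξ(s) + M(s)`;
* **`MatiyasevichSaidakZvengrowski2014_thm1_3B`** — Theorem 1.3 (B): `Re ζ′/ζ(s) < Re ξ′/ξ(s)` for
  `|t| ≥ 8` at every `s` with `ζ(s) ≠ 0` (the printed restriction `σ < 1/2` is not needed and not assumed);
* `MatiyasevichSaidakZvengrowski2014.re_logDeriv_riemannZeta_neg_of_re_le_zero` — `Re ζ′/ζ(s) < 0` for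
  `σ ≤ 0`, `|t| ≥ 8` (proof of Thm 3.4), and **`MatiyasevichSaidakZvengrowski2014_thm1_4_zeta`** — Theorem 1.4
  for `ζ`, unconditional clause: `σ ↦ |ζ(σ+it)|` is strictly decreasing on `σ ≤ 0` for every `|t| ≥ 8`;
* `norm_riemannZeta_strictAntiOn_Iic_half_of_RH` (under RH the region extends to `σ ≤ 1/2`),
  `riemannHypothesis_of_norm_riemannZeta_strictAntiOn_Icc` (strict decrease on `0 ≤ σ ≤ 1/2` for all
  `|t| ≥ 8` already gives RH) and **`riemannHypothesis_iff_norm_riemannZeta_strictAntiOn`** — Theorem 1.4 for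
  `ζ`, second clause: `RH ⟺ ∀ |t| ≥ 8, σ ↦ |ζ(σ+it)|` strictly decreasing on `σ ≤ 1/2`;
* `MatiyasevichSaidakZvengrowski2014.re_one_div_two_cpow_sub_one_neg` — **Lemma 3.1**
  (`Re 1/(2^{s−1} − 1) < 0` for `σ < 1`), `….logDeriv_dirichletEta_eq` (`η′/η = log 2/(2^{s−1} − 1) + ζ′/ζ`),
  **`MatiyasevichSaidakZvengrowski2014_thm1_3A`** — Theorem 1.3 (A):
  `Re η′/η(s) < Re ζ′/ζ(s)` for `σ < 1`, `ζ(s) ≠ 0` ("indeed for `σ < 1`");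
* **`MatiyasevichSaidakZvengrowski2014_thm1_4_eta`**, `norm_dirichletEta_strictAntiOn_Iic_half_of_RH`,
  `riemannHypothesis_of_norm_dirichletEta_strictAntiOn_Icc`, **`riemannHypothesis_iff_norm_dirichletEta_strictAntiOn`**
  — Theorem 1.4 for `η` (both clauses);
* **`MatiyasevichSaidakZvengrowski2014_thm1_4_xi`** (`|ξ(σ+it)|` strictly decreasing on `σ ≤ 0`, every `t`) and
  **`riemannHypothesis_iff_norm_riemannXi_strictAntiOn_Iic`** (`RH ⟺` strict decrease on `σ ≤ 1/2`, every `t`)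
  — Theorem 1.4 for `ξ` with the printed closed endpoints; the open-ray forms are Sondow–Dumitrescu's
  (tree: `SondowDumitrescu2010.norm_riemannXi_strictAntiOn_Iio_zero`,
  `SondowDumitrescu2010.riemannHypothesis_iff_norm_riemannXi_strictAntiOn`, `XiModulusMonotone.lean`).

Labels: Theorem 1.3 and the `σ ≤ 0` clauses are **RH-FREE** theorems about `η`, `ζ`, `ξ`; the three criteria
are **RH-EQUIVALENT** (equivalences proved, neither side asserted). Nothing here bears on the truth of RH.

## Proof (as printed, §§2–3) and one DEVIATION

Lemma 2.1/2.3 (`Re f′/f = ∂_σ log|f|`; sign of `Re f′/f` ⟹ strict monotonicity of `|f|` in `σ`) is run, as in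
`XiModulusMonotone.lean`, through `d/dσ |f(σ+it)|² = 2|f|² Re f′/f` (`HasDerivAt.norm_sq`) and
`strictAntiOn_of_deriv_neg` on a convex set of `σ`'s, for `f = ζ, η, ξ` (private generic lemmas). Proof of (A)
(§3): `η′/η = log 2/(2^{s−1} − 1) + ζ′/ζ` (`logDeriv_mul` near `s ≠ 1`) and Lemma 3.1 via
`Re 2^{s−1} ≤ |2^{s−1}| = 2^{σ−1} < 1`. Proof of (B) (§3): by the displayed identity it
suffices that `Re(1/(s−1) + ½Ψ(s/2+1)) − ½ log π > 0`; "by Lemma 3.2 (iv), the first term is `≥ −1/16`",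
`½ log π < 0.578` (tree), and `½ Re Ψ(s/2+1) ≥ 0.6524`. DEVIATION (recorded, not editorialised): the paper
bounds `½ Re Ψ(z)`, `z = s/2+1`, below by `1.0048` quoting Lemma 3.2 (v) (`Re Ψ(s) > 2.0096` for
`σ ≥ 1/2`, `|t| ≥ 8`) — but `Im z = t/2` only satisfies `|Im z| ≥ 4`; we prove instead, from the tree's
second-order Stirling bound `|Re ψ(w) − log‖w‖ + Re 1/(2w)| ≤ 1/(6|Im w|³) + π/(12 (Im w)²)`
(`Complex.abs_re_digamma_sub_log_norm_add_re_le`, valid for `Re w > 0`) and `Re 1/(2w) ≤ 1/(4|Im w|)`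
(Lemma 3.2 (iv)), that `Re ψ(w) ≥ 2 log 2 − 1/16 − 1/384 − π/192 ≥ 1.3048` for `Re w > 0`, `|Im w| ≥ 4`,
and extend to `Re w ≤ 0` by `ψ(w) = ψ(w+1) − 1/w` with `Re(−1/w) = −Re w/|w|² ≥ 0` (the role of the
reflection step Lemma 3.2 (ii) in the paper). The margin is `1/16 + 0.578 − 0.6524 = −0.0119 < 0`.
Theorem 1.4: for `σ ≤ 0`, `Re ξ′/ξ(s) = −Re ξ′/ξ(1−s) < 0` (tree: Lagarias (1.4) on `Re ≥ 1`,
`Lagarias1999Eq14.re_logDeriv_riemannXi_pos_of_one_le_re`, and `ξ′/ξ(1−s) = −ξ′/ξ(s)`), so (B) gives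
`Re ζ′/ζ < 0`; under RH the same holds for `σ < 1/2` (tree: `Lagarias1999_riemannHypothesis_iff_holds`);
conversely ("the same argument used in Corollary 2.5": a modulus strictly monotone in `σ` has no zeros) a
zero `ρ = β+iγ` with `0 < β < 1/2` (reflect one with `β > 1/2` by `ζ(1−s̄)`-symmetry) has `|γ| > 14 ≥ 8`
(tree's first-zero certificate `riemannZeta_ne_zero_of_im_pos_of_im_le_fourteen`), and strict decrease on
`[β, 1/2]` would force `|ζ(1/2+iγ)| < |ζ(ρ)| = 0`.

## References

* [MatiyasevichSaidakZvengrowski2014] Yu. Matiyasevich, F. Saidak, P. Zvengrowski, Acta Arith. 166 (2014)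
  189–200, Thm 1.3, Thm 1.4 (= Thm 3.4), Lemmas 2.1–2.3, 3.1, 3.2.
* [LevinsonMontgomery1974] N. Levinson, H. L. Montgomery, Acta Math. 133 (1974), §2 (2.1), (2.4) — `M(s)`.
* [SondowDumitrescu2010] J. Sondow, C. Dumitrescu, Period. Math. Hungar. 60 (2010) 37–40 — the `ξ`-form.
* [LagariasXiPositivity1999] J. C. Lagarias, Acta Arith. 89 (1999) 217–234, (1.4)–(1.5).
-/

noncomputable section

open Complex Filter Topology Set
open scoped Real ComplexConjugate

namespace Literature.NumberTheory.LFunctions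

namespace MatiyasevichSaidakZvengrowski2014

/-! ## Lemma 3.2-type bounds: `Re ψ(w) ≥ 1.3048` for `|Im w| ≥ 4`; the pole term -/

/-- `Re 1/(2w) = Re w/(2‖w‖²) ≤ 1/(4|Im w|) ≤ 1/16` for `|Im w| ≥ 4` (Lemma 3.2 (iv):
"`|x/(x²+t²)| ≤ 1/(2|t|)`", i.e. `0 ≤ (|x| − |t|)²`). [cite: MatiyasevichSaidakZvengrowski2014, Lemma 3.2 (iv)] -/
theorem re_one_div_two_mul_le {w : ℂ} (hw : 4 ≤ |w.im|) : (1 / (2 * w)).re ≤ 1 / 16 := by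
  have him : w.im ≠ 0 := by
    intro h; rw [h, abs_zero] at hw; linarith
  have hw0 : w ≠ 0 := fun h ↦ by rw [h] at him; simp at him
  have hy2 : 16 ≤ w.im ^ 2 := by
    have := pow_le_pow_left₀ (by norm_num) hw 2
    rw [sq_abs] at this; nlinarith
  have hnsq : Complex.normSq (2 * w) = 4 * (w.re ^ 2 + w.im ^ 2) := by
    rw [Complex.normSq_apply]; simp; ring
  have hden : 0 < 4 * (w.re ^ 2 + w.im ^ 2) := by positivity
  rw [one_div, Complex.inv_re, hnsq]
  simp only [Complex.mul_re, Complex.re_ofNat, Complex.im_ofNat, zero_mul, sub_zero]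
  rw [div_le_iff₀ hden]
  nlinarith [sq_nonneg (w.re - 4)]

/-- For `Re w > 0`, `|Im w| ≥ 4`: `Re ψ(w) ≥ 2 log 2 − 1/16 − (1/384 + π/192) ≥ 1.3048` — second-order
Stirling (`|Re ψ(w) − log‖w‖ + Re 1/(2w)| ≤ 1/(6|Im w|³) + π/(12 (Im w)²)`, tree), `log ‖w‖ ≥ log |Im w| ≥ log 4`
and Lemma 3.2 (iv). (The paper's Lemma 3.2 (iii)/(v) use Stieltjes' sector bound instead.)
[cite: MatiyasevichSaidakZvengrowski2014, Lemma 3.2 (iii)–(v)] -/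
theorem re_digamma_ge_of_re_pos {w : ℂ} (hre : 0 < w.re) (hw : 4 ≤ |w.im|) :
    (1.3048 : ℝ) ≤ (Complex.digamma w).re := by
  have him : w.im ≠ 0 := by
    intro h; rw [h, abs_zero] at hw; linarith
  have hψ := Literature.NumberTheory.LFunctions.Complex.abs_re_digamma_sub_log_norm_add_re_le hre him
  have hy2 : 16 ≤ w.im ^ 2 := by
    have := pow_le_pow_left₀ (by norm_num) hw 2
    rw [sq_abs] at this; nlinarith
  have hy3 : 64 ≤ |w.im| ^ 3 := by
    have := pow_le_pow_left₀ (by norm_num) hw 3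
    nlinarith
  have hE1 : 1 / (6 * |w.im| ^ 3) ≤ 1 / 384 :=
    one_div_le_one_div_of_le (by norm_num) (by nlinarith)
  have hE2 : π / (12 * w.im ^ 2) ≤ 3.1416 / 192 := by
    rw [div_le_div_iff₀ (by positivity) (by norm_num)]
    have hπ := Real.pi_lt_d4
    nlinarith [Real.pi_pos]
  have hE : 1 / (6 * |w.im| ^ 3) + π / (12 * w.im ^ 2) ≤ 1 / 384 + 3.1416 / 192 := add_le_add hE1 hE2
  have hR := re_one_div_two_mul_le hw
  have hnorm : (4 : ℝ) ≤ ‖w‖ := hw.trans (Complex.abs_im_le_norm w)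
  have hlog : Real.log 4 ≤ Real.log ‖w‖ := Real.log_le_log (by norm_num) hnorm
  have hlog4 : Real.log 4 = 2 * Real.log 2 := by
    rw [show (4 : ℝ) = 2 ^ 2 by norm_num, Real.log_pow]; push_cast; ring
  have hl2 := Real.log_two_gt_d9
  have h1 := (abs_le.1 hψ).1
  rw [hlog4] at hlog
  norm_num at hl2 hE ⊢
  linarith

/-- **`Re ψ(w) ≥ 1.3048` for every `w` with `|Im w| ≥ 4`** (all `Re w`): for `Re w ≤ 0` shift right by
`ψ(w) = ψ(w+1) − 1/w`, where `Re(−1/w) = −Re w/|w|² ≥ 0` (this replaces the reflection step, Lemma 3.2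
(ii), of the paper). [cite: MatiyasevichSaidakZvengrowski2014, Lemma 3.2 (ii),(v)] -/
theorem re_digamma_ge_of_four_le_abs_im {w : ℂ} (hw : 4 ≤ |w.im|) :
    (1.3048 : ℝ) ≤ (Complex.digamma w).re := by
  -- induction on `n` with `-n < Re w`
  have key : ∀ n : ℕ, ∀ w : ℂ, -(n : ℝ) < w.re → 4 ≤ |w.im| →
      (1.3048 : ℝ) ≤ (Complex.digamma w).re := by
    intro n
    induction n with
    | zero =>
      intro w hre hw
      exact re_digamma_ge_of_re_pos (by simpa using hre) hw
    | succ n ih =>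
      intro w hre hw
      by_cases h : -(n : ℝ) < w.re
      · exact ih w h hw
      · push Not at h
        have hre0 : w.re ≤ 0 := h.trans (by simp)
        have him : w.im ≠ 0 := by
          intro h0; rw [h0, abs_zero] at hw; linarith
        have hpole : ∀ m : ℕ, w ≠ -m := by
          intro m hm
          have := congrArg Complex.im hm
          simp at this
          exact him this
        have hrec := Complex.digamma_apply_add_one w hpole
        have ih' := ih (w + 1) (by push_cast at hre ⊢; simp; linarith) (by simpa using hw)
        have hinv : (w⁻¹).re ≤ 0 := by
          rw [Complex.inv_re]
          exact div_nonpos_of_nonpos_of_nonneg hre0 (Complex.normSq_nonneg w)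
        rw [hrec, add_re] at ih'
        linarith
  obtain ⟨n, hn⟩ := exists_nat_gt (-w.re)
  exact key n w (by linarith) hw

/-- The pole term for `|t| ≥ 8`, every `σ`: `−Re 1/(s−1) = (1−σ)/((1−σ)²+t²) ≤ 1/(2|t|) ≤ 1/16`
("by Lemma 3.2 (iv), the first term is greater than or equal to `−1/16`").
[cite: MatiyasevichSaidakZvengrowski2014, §3 proof of (B)] -/
theorem neg_re_one_div_sub_one_le_sixteenth {s : ℂ} (ht : 8 ≤ |s.im|) :
    -(1 / (s - 1)).re ≤ 1 / 16 := by
  rw [re_one_div_sub]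
  simp only [one_re, one_im, sub_zero]
  have ht2 : 64 ≤ s.im ^ 2 := by nlinarith [abs_nonneg s.im, sq_abs s.im]
  have hden : 0 < (s.re - 1) ^ 2 + s.im ^ 2 := by positivity
  have key : -(1 / 16) * ((s.re - 1) ^ 2 + s.im ^ 2) ≤ s.re - 1 := by
    nlinarith [sq_nonneg (s.re - 1 + 8)]
  have := (le_div_iff₀ hden).2 key
  linarith

end MatiyasevichSaidakZvengrowski2014

open MatiyasevichSaidakZvengrowski2014

/-- **The `Γ`-part is negative for `|t| ≥ 8`, every `σ`**: Levinson–Montgomery's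
`M(s) = −Re 1/(s−1) + ½ log π − ½ Re ψ(s/2+1) ≤ 1/16 + 0.578 − 0.6524 < 0` (LM (2.4) gives
`M(s) = −½ log(t/2π) + O(1/t)`; this is inequality (B) of Matiyasevich–Saidak–Zvengrowski, Thm 1.3, in the
tree's notation: `Re(1/(s−1) + ½Ψ(s/2+1)) − ½ log π > 0` for `|t| ≥ 8`).
[cite: MatiyasevichSaidakZvengrowski2014, Thm 1.3 (B) and §3 proof of (B)]
[cite: LevinsonMontgomery1974, §2 eq. (2.4)] -/
theorem lmGammaRe_neg_of_eight_le_abs_im {s : ℂ} (ht : 8 ≤ |s.im|) : lmGammaRe s < 0 := by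
  set w : ℂ := s / 2 + 1 with hw
  have hwim : w.im = s.im / 2 := by simp [hw]
  have hw4 : 4 ≤ |w.im| := by
    rw [hwim, abs_div, abs_two]; linarith
  have hψ : (1631 / 1250 : ℝ) ≤ (Complex.digamma w).re := by
    have := re_digamma_ge_of_four_le_abs_im hw4
    norm_num at this
    exact this
  have hP := neg_re_one_div_sub_one_le_sixteenth ht
  have hπ := half_log_pi_le
  have hgoal : lmGammaRe s =
      -(1 / (s - 1)).re + Real.log π / 2 - (Complex.digamma w).re / 2 := rfl
  rw [hgoal]
  linarith

namespace MatiyasevichSaidakZvengrowski2014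

/-! ## Theorem 1.3 (B): `Re ζ′/ζ < Re ξ′/ξ` -/

/-- **The displayed identity of §3, proof of (B)**: "Taking the logarithmic derivative of the formula … for
`ξ(s)` gives `ξ′(s)/ξ(s) = ζ′(s)/ζ(s) + 1/(s−1) + ½Ψ(s/2+1) − ½ log π`", here for `ζ(s) ≠ 0`, `s ≠ 1`,
`Re s > 0` or `Im s ≠ 0` (from the tree's Levinson–Montgomery (2.1), `XiProduct.logDeriv_riemannZeta'`, and
`XiProduct.logDeriv_riemannXi_symm`). [cite: MatiyasevichSaidakZvengrowski2014, §3 proof of (B)] -/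
theorem logDeriv_riemannZeta_eq {s : ℂ} (hζ : riemannZeta s ≠ 0) (hs1 : s ≠ 1)
    (hs : 0 < s.re ∨ s.im ≠ 0) :
    logDeriv riemannZeta s = logDeriv riemannXi s - 1 / (s - 1) + (Real.log Real.pi : ℂ) / 2 -
      Complex.digamma (s / 2 + 1) / 2 := by
  have hξ : riemannXi s ≠ 0 := fun h ↦ hζ (riemannZeta_eq_zero_of_riemannXi_eq_zero h).2.2
  have h1 := lmXiProduct.logDeriv_riemannZeta' hζ hs1 hs
  obtain ⟨h2, -⟩ := lmXiProduct.logDeriv_riemannXi_symm hξ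
  rw [h1, ← h2]

/-- Real part of the identity: `Re ζ′/ζ(s) = Re ξ′/ξ(s) + M(s)`, `M = lmGammaRe`.
[cite: MatiyasevichSaidakZvengrowski2014, §3 proof of (B)] -/
theorem re_logDeriv_riemannZeta_eq {s : ℂ} (hζ : riemannZeta s ≠ 0) (hs1 : s ≠ 1)
    (hs : 0 < s.re ∨ s.im ≠ 0) :
    (logDeriv riemannZeta s).re = (logDeriv riemannXi s).re + lmGammaRe s := by
  rw [logDeriv_riemannZeta_eq hζ hs1 hs]
  simp only [sub_re, add_re, Complex.div_ofNat_re, Complex.ofReal_re, lmGammaRe]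
  ring

end MatiyasevichSaidakZvengrowski2014

/-- **Matiyasevich–Saidak–Zvengrowski 2014, Theorem 1.3 (B)**: "For `|t| ≥ 8`, `σ < 1/2`, one has
`Re(ζ′(s)/ζ(s)) < Re(ξ′(s)/ξ(s))`" — here at every `s` with `|Im s| ≥ 8` and `ζ(s) ≠ 0` (where both
logarithmic derivatives are meaningful); the printed restriction `σ < 1/2` is not used.
[cite: MatiyasevichSaidakZvengrowski2014, Thm 1.3 (B)] -/
theorem MatiyasevichSaidakZvengrowski2014_thm1_3B {s : ℂ} (ht : 8 ≤ |s.im|)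
    (hζ : riemannZeta s ≠ 0) :
    (logDeriv riemannZeta s).re < (logDeriv riemannXi s).re := by
  have him : s.im ≠ 0 := by
    intro h; rw [h, abs_zero] at ht; linarith
  have hs1 : s ≠ 1 := by
    intro h; rw [h] at him; simp at him
  rw [MatiyasevichSaidakZvengrowski2014.re_logDeriv_riemannZeta_eq hζ hs1 (Or.inr him)]
  linarith [lmGammaRe_neg_of_eight_le_abs_im ht]

namespace MatiyasevichSaidakZvengrowski2014

/-! ## Signs of `Re ξ′/ξ` and `Re ζ′/ζ` left of the critical line -/

/-- `Re ξ′/ξ(s) < 0` for `σ ≤ 0` ("for `σ ≤ 0`, we have seen in the proof of [Cor.] 2.5 that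
`Re(ξ′(s)/ξ(s)) < 0`"): `ξ′/ξ(s) = −ξ′/ξ(1−s)` and `Re ξ′/ξ > 0` on `Re ≥ 1` (tree, Lagarias (1.4)).
[cite: MatiyasevichSaidakZvengrowski2014, §3 proof of Thm 3.4] -/
theorem re_logDeriv_riemannXi_neg_of_re_le_zero {s : ℂ} (hs : s.re ≤ 0) :
    (logDeriv riemannXi s).re < 0 := by
  have h := Lagarias1999Eq14.re_logDeriv_riemannXi_pos_of_one_le_re (s := 1 - s)
    (by simp only [sub_re, one_re]; linarith)
  rw [logDeriv_riemannXi_one_sub, neg_re] at h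
  linarith

/-- Under RH, `Re ξ′/ξ(s) < 0` for `σ < 1/2` (Lagarias (1.5), tree: `RH ⟺ Re ξ′/ξ > 0` on `Re s > 1/2`;
reflect by `ξ′/ξ(1−s) = −ξ′/ξ(s)`). [cite: MatiyasevichSaidakZvengrowski2014, §2 (after Cor 2.5)] -/
theorem re_logDeriv_riemannXi_neg_of_RH (hRH : RiemannHypothesis) {s : ℂ} (hs : s.re < 1 / 2) :
    (logDeriv riemannXi s).re < 0 := by
  have h := (Lagarias1999_riemannHypothesis_iff_holds.1 hRH) (1 - s)
    (by simp only [sub_re, one_re]; linarith)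
  rw [logDeriv_riemannXi_one_sub, neg_re] at h
  linarith

/-- `ζ(s) ≠ 0` for `σ ≤ 0`, `t ≠ 0` (the zeros of `ζ` in `Re s ≤ 0` are the trivial ones). [folklore] -/
private theorem riemannZeta_ne_zero_of_re_le_zero {s : ℂ} (hs : s.re ≤ 0) (him : s.im ≠ 0) :
    riemannZeta s ≠ 0 := by
  rw [Ne, riemannZeta_eq_zero_iff_of_re_nonpos hs]
  rintro ⟨n, hn⟩
  have := congrArg Complex.im hn
  simp at this
  exact him this

/-- Under RH, `ζ(s) ≠ 0` for `σ < 1/2`, `t ≠ 0`. [folklore] -/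
private theorem riemannZeta_ne_zero_of_RH {s : ℂ} (hRH : RiemannHypothesis) (hs : s.re < 1 / 2)
    (him : s.im ≠ 0) : riemannZeta s ≠ 0 := by
  rcases le_or_gt s.re 0 with h0 | h0
  · exact riemannZeta_ne_zero_of_re_le_zero h0 him
  · intro hz
    have h := hRH s hz ?_ ?_
    · linarith
    · rintro ⟨n, hn⟩
      have := congrArg Complex.im hn
      simp at this
      exact him this
    · intro h1; rw [h1] at him; simp at him

/-- **`Re ζ′/ζ(s) < 0` for `σ ≤ 0`, `|t| ≥ 8`** ("combining this with the inequalities in Theorem [1.3]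
shows that the same is true for `ζ`"). [cite: MatiyasevichSaidakZvengrowski2014, §3 proof of Thm 3.4] -/
theorem re_logDeriv_riemannZeta_neg_of_re_le_zero {s : ℂ} (hs : s.re ≤ 0) (ht : 8 ≤ |s.im|) :
    (logDeriv riemannZeta s).re < 0 := by
  have him : s.im ≠ 0 := by
    intro h; rw [h, abs_zero] at ht; linarith
  have h1 := MatiyasevichSaidakZvengrowski2014_thm1_3B ht (riemannZeta_ne_zero_of_re_le_zero hs him)
  have h2 := re_logDeriv_riemannXi_neg_of_re_le_zero hs
  linarith

/-- Under RH, `Re ζ′/ζ(s) < 0` for `σ < 1/2`, `|t| ≥ 8`. [cite: MatiyasevichSaidakZvengrowski2014, §3 proof of Thm 3.4] -/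
theorem re_logDeriv_riemannZeta_neg_of_RH (hRH : RiemannHypothesis) {s : ℂ} (hs : s.re < 1 / 2)
    (ht : 8 ≤ |s.im|) : (logDeriv riemannZeta s).re < 0 := by
  have him : s.im ≠ 0 := by
    intro h; rw [h, abs_zero] at ht; linarith
  have h1 := MatiyasevichSaidakZvengrowski2014_thm1_3B ht (riemannZeta_ne_zero_of_RH hRH hs him)
  have h2 := re_logDeriv_riemannXi_neg_of_RH hRH hs
  linarith

/-! ## Lemma 2.1 / 2.3 on a horizontal line (for any holomorphic `f`) -/

/-- The restriction of `f` to the horizontal line `Im s = t` is real-differentiable at `σ`, with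
derivative `f′(σ + it)`, wherever `f` is complex-differentiable. [folklore] -/
private theorem hasDerivAt_horizontal {f : ℂ → ℂ} {σ t : ℝ}
    (hf : DifferentiableAt ℂ f ((σ : ℂ) + t * I)) :
    HasDerivAt (fun x : ℝ => f ((x : ℂ) + t * I)) (deriv f ((σ : ℂ) + t * I)) σ := by
  have h1 : HasDerivAt (fun z : ℂ => f (z + t * I)) (deriv f ((σ : ℂ) + t * I)) (σ : ℂ) := by
    have hd := hf.hasDerivAt
    have h2 : HasDerivAt (fun z : ℂ => z + t * I) 1 (σ : ℂ) := (hasDerivAt_id (σ : ℂ)).add_const _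
    have h3 := hd.comp (σ : ℂ) h2
    simp only [mul_one, Function.comp_def] at h3
    exact h3
  exact h1.comp_ofReal

/-- Lemma 2.1 in squared form: `d/dσ |f(σ + it)|² = 2 Re(conj f(σ + it) · f′(σ + it))`. [folklore] -/
private theorem hasDerivAt_norm_sq_horizontal {f : ℂ → ℂ} {σ t : ℝ}
    (hf : DifferentiableAt ℂ f ((σ : ℂ) + t * I)) :
    HasDerivAt (fun x : ℝ => ‖f ((x : ℂ) + t * I)‖ ^ 2)
      (2 * (conj (f ((σ : ℂ) + t * I)) * deriv f ((σ : ℂ) + t * I)).re) σ := by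
  have h := (hasDerivAt_horizontal hf).norm_sq
  rw [Complex.inner, mul_comm (deriv f _)] at h
  exact h

/-- Corollary 2.2: where `Re f′/f < 0`, the `σ`-derivative of `|f|²` is negative, since
`Re(conj f · f′) = |f|² · Re(f′/f)`. [folklore] -/
private theorem re_conj_mul_deriv_neg {f : ℂ → ℂ} {s : ℂ} (h : (logDeriv f s).re < 0) :
    (conj (f s) * deriv f s).re < 0 := by
  have hne : f s ≠ 0 := by
    intro h0
    simp [logDeriv_apply, h0] at h
  have key : conj (f s) * deriv f s = ((Complex.normSq (f s) : ℝ) : ℂ) * logDeriv f s := by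
    rw [logDeriv_apply, Complex.normSq_eq_conj_mul_self]
    field_simp
  rw [key, Complex.re_ofReal_mul]
  exact mul_neg_of_pos_of_neg (Complex.normSq_pos.2 hne) h

/-- Lemma 2.3 (a) along a horizontal line: if `f` is holomorphic at the points `σ + it` and
`Re f′/f(σ + it) < 0` at every interior point of a convex set `S` of abscissae, then `σ ↦ |f(σ + it)|` is
strictly decreasing on `S` (mean value theorem for `|f|²`). [folklore] -/
private theorem norm_strictAntiOn_of_re_logDeriv_neg {f : ℂ → ℂ} {S : Set ℝ} (hS : Convex ℝ S) {t : ℝ}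
    (hdiff : ∀ σ : ℝ, DifferentiableAt ℂ f ((σ : ℂ) + t * I))
    (hneg : ∀ σ ∈ interior S, (logDeriv f ((σ : ℂ) + t * I)).re < 0) :
    StrictAntiOn (fun σ : ℝ => ‖f ((σ : ℂ) + t * I)‖) S := by
  have hsq : StrictAntiOn (fun σ : ℝ => ‖f ((σ : ℂ) + t * I)‖ ^ 2) S := by
    refine strictAntiOn_of_deriv_neg hS ?_ ?_
    · have hc : Continuous fun σ : ℝ => f ((σ : ℂ) + t * I) :=
        continuous_iff_continuousAt.2 fun σ => (hasDerivAt_horizontal (hdiff σ)).continuousAt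
      exact ((continuous_norm.comp hc).pow 2).continuousOn
    · intro x hx
      rw [(hasDerivAt_norm_sq_horizontal (hdiff x)).deriv]
      have := re_conj_mul_deriv_neg (hneg x hx)
      linarith
  intro a ha b hb hab
  exact lt_of_pow_lt_pow_left₀ 2 (norm_nonneg _) (hsq ha hb hab)

/-- `ζ` is differentiable at the points of a horizontal line `Im s = t ≠ 0`. [folklore] -/
private theorem differentiableAt_riemannZeta_horizontal {t : ℝ} (ht : t ≠ 0) (σ : ℝ) :
    DifferentiableAt ℂ riemannZeta ((σ : ℂ) + t * I) := by
  refine differentiableAt_riemannZeta fun h ↦ ?_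
  have := congrArg Complex.im h
  simp at this
  exact ht this

/-- A zero `ρ` of `ζ` with `0 < Re ρ < 1` has `|Im ρ| > 14` (the tree's certificate that `ζ` has no zero
with `0 < Im s ≤ 14`, and conjugation), in particular `|Im ρ| ≥ 8`. [folklore] -/
private theorem eight_le_abs_im_of_zero {ρ : ℂ} (hζ : riemannZeta ρ = 0) (h0 : 0 < ρ.re) (h1 : ρ.re < 1) :
    8 ≤ |ρ.im| := by
  have him : ρ.im ≠ 0 := im_ne_zero_of_riemannZeta_eq_zero hζ h0 h1
  rcases lt_or_gt_of_ne him with hneg | hpos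
  · have hc : riemannZeta (conj ρ) = 0 := by rw [riemannZeta_conj, hζ, map_zero]
    have h14 : ¬ (conj ρ).im ≤ 14 := fun hle ↦
      riemannZeta_ne_zero_of_im_pos_of_im_le_fourteen (by simp; linarith) hle hc
    simp only [conj_im, not_le] at h14
    rw [abs_of_neg hneg]; linarith
  · have h14 : ¬ ρ.im ≤ 14 := fun hle ↦ riemannZeta_ne_zero_of_im_pos_of_im_le_fourteen hpos hle hζ
    rw [abs_of_pos hpos]; linarith

end MatiyasevichSaidakZvengrowski2014

/-! ## Theorem 1.4 for `ζ` -/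

/-- **Matiyasevich–Saidak–Zvengrowski 2014, Theorem 1.4 (= 3.4) for `ζ`, unconditional clause**: for every
`t` with `|t| ≥ 8`, `σ ↦ |ζ(σ + it)|` is strictly decreasing on `σ ≤ 0`.
[cite: MatiyasevichSaidakZvengrowski2014, Thm 1.4] -/
theorem MatiyasevichSaidakZvengrowski2014_thm1_4_zeta {t : ℝ} (ht : 8 ≤ |t|) :
    StrictAntiOn (fun σ : ℝ => ‖riemannZeta ((σ : ℂ) + t * I)‖) (Iic 0) := by
  have ht0 : t ≠ 0 := by
    intro h; rw [h, abs_zero] at ht; linarith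
  refine norm_strictAntiOn_of_re_logDeriv_neg (convex_Iic 0) (differentiableAt_riemannZeta_horizontal ht0)
    fun σ hσ ↦ ?_
  rw [interior_Iic] at hσ
  exact re_logDeriv_riemannZeta_neg_of_re_le_zero (by simpa using hσ.le) (by simpa using ht)

/-- Under RH the region extends: for every `|t| ≥ 8`, `σ ↦ |ζ(σ + it)|` is strictly decreasing on
`σ ≤ 1/2`. [cite: MatiyasevichSaidakZvengrowski2014, Thm 1.4] -/
theorem norm_riemannZeta_strictAntiOn_Iic_half_of_RH (hRH : RiemannHypothesis) {t : ℝ} (ht : 8 ≤ |t|) :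
    StrictAntiOn (fun σ : ℝ => ‖riemannZeta ((σ : ℂ) + t * I)‖) (Iic (1 / 2)) := by
  have ht0 : t ≠ 0 := by
    intro h; rw [h, abs_zero] at ht; linarith
  refine norm_strictAntiOn_of_re_logDeriv_neg (convex_Iic _) (differentiableAt_riemannZeta_horizontal ht0)
    fun σ hσ ↦ ?_
  rw [interior_Iic] at hσ
  exact re_logDeriv_riemannZeta_neg_of_RH hRH (by simpa using hσ) (by simpa using ht)

/-- **Converse clause** ("the same argument used in Corollary 2.5": a modulus strictly decreasing in `σ`
cannot vanish before the end of the interval): if for every `|t| ≥ 8` the map `σ ↦ |ζ(σ + it)|` is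
strictly decreasing on `0 ≤ σ ≤ 1/2`, then RH holds — a zero `β + iγ` with `0 < β < 1/2` (reflect one with
`β > 1/2`) has `|γ| > 14` and would give `|ζ(1/2 + iγ)| < |ζ(β + iγ)| = 0`.
[cite: MatiyasevichSaidakZvengrowski2014, Thm 1.4 and proof of Thm 3.4] -/
theorem riemannHypothesis_of_norm_riemannZeta_strictAntiOn_Icc
    (h : ∀ t : ℝ, 8 ≤ |t| → StrictAntiOn (fun σ : ℝ => ‖riemannZeta ((σ : ℂ) + t * I)‖) (Icc 0 (1 / 2))) :
    RiemannHypothesis := by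
  rw [show RiemannHypothesis ↔ RiemannHypothesisStrip from riemannHypothesis_iff_strip_holds]
  have key : ∀ ρ : ℂ, riemannZeta ρ = 0 → 0 < ρ.re → ρ.re < 1 / 2 → False := by
    intro ρ hζ h0 h1
    have hγ : 8 ≤ |ρ.im| := eight_le_abs_im_of_zero hζ h0 (by linarith)
    have hlt := h ρ.im hγ ⟨h0.le, h1.le⟩ ⟨by norm_num, le_rfl⟩ h1
    have hρ : ((ρ.re : ℂ) + ρ.im * I) = ρ := Complex.ext (by simp) (by simp)
    simp only [hρ, hζ, norm_zero] at hlt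
    exact absurd hlt (not_lt.2 (norm_nonneg _))
  intro s hζ h0 h1
  by_contra hne
  rcases lt_or_gt_of_ne hne with hlt | hgt
  · exact key s hζ h0 hlt
  · exact key (1 - s) (GeneralizedRH.riemannZeta_one_sub_eq_zero hζ h0 h1)
      (by simp only [sub_re, one_re]; linarith) (by simp only [sub_re, one_re]; linarith)

/-- **Matiyasevich–Saidak–Zvengrowski 2014, Theorem 1.4 (= 3.4) for `ζ`, second clause**: "Extending this
region [`σ ≤ 0`, `|t| ≥ 8`, where `|ζ|` is monotone decreasing in `σ`] to `σ ≤ 1/2 …` is equivalent to the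
Riemann hypothesis": `RH ⟺` for every `|t| ≥ 8`, `σ ↦ |ζ(σ + it)|` is strictly decreasing on `σ ≤ 1/2`.
RH-EQUIVALENT (both directions proved). [cite: MatiyasevichSaidakZvengrowski2014, Thm 1.4] -/
theorem riemannHypothesis_iff_norm_riemannZeta_strictAntiOn :
    RiemannHypothesis ↔
      ∀ t : ℝ, 8 ≤ |t| → StrictAntiOn (fun σ : ℝ => ‖riemannZeta ((σ : ℂ) + t * I)‖) (Iic (1 / 2)) := by
  refine ⟨fun hRH t ht ↦ norm_riemannZeta_strictAntiOn_Iic_half_of_RH hRH ht, fun h ↦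
    riemannHypothesis_of_norm_riemannZeta_strictAntiOn_Icc fun t ht ↦ (h t ht).mono ?_⟩
  exact fun σ hσ ↦ hσ.2

/-! ## The `η`-clauses: Lemma 3.1, Theorem 1.3 (A), Theorem 1.4 for `η` -/

namespace MatiyasevichSaidakZvengrowski2014

/-- For `σ < 1`: `Re 2^{s−1} ≤ |2^{s−1}| = 2^{σ−1} < 1`, so `Re(2^{s−1} − 1) < 0` (proof of Lemma 3.1:
"`|2^{σ−1} cos(t log 2)| < 1`, so the numerator is strictly negative"). [folklore] -/
private theorem re_two_cpow_sub_one_neg {s : ℂ} (hσ : s.re < 1) : ((2 : ℂ) ^ (s - 1) - 1).re < 0 := by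
  have hn : ‖(2 : ℂ) ^ (s - 1)‖ = (2 : ℝ) ^ (s - 1).re := by
    have := Complex.norm_cpow_eq_rpow_re_of_pos two_pos (s - 1)
    simpa using this
  have hlt : (2 : ℝ) ^ (s - 1).re < 1 :=
    Real.rpow_lt_one_of_one_lt_of_neg one_lt_two (by simp only [sub_re, one_re]; linarith)
  have hre : ((2 : ℂ) ^ (s - 1)).re ≤ ‖(2 : ℂ) ^ (s - 1)‖ := Complex.re_le_norm _
  simp only [sub_re, one_re]
  linarith

/-- `2^{s−1} − 1 ≠ 0` for `σ < 1` ("`2^{s−1} − 1 = 0` if and only if `s = 1 + 2nπi/log 2`").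
[folklore] -/
private theorem two_cpow_sub_one_ne_zero {s : ℂ} (hσ : s.re < 1) : (2 : ℂ) ^ (s - 1) - 1 ≠ 0 := by
  intro h0
  have h := re_two_cpow_sub_one_neg hσ
  rw [h0] at h
  simp at h

/-- **Lemma 3.1**: "For `σ < 1`, one has `Re(1/(2^{s−1} − 1)) < 0`."
[cite: MatiyasevichSaidakZvengrowski2014, Lemma 3.1] -/
theorem re_one_div_two_cpow_sub_one_neg {s : ℂ} (hσ : s.re < 1) :
    (1 / ((2 : ℂ) ^ (s - 1) - 1)).re < 0 := by
  rw [one_div, Complex.inv_re]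
  exact div_neg_of_neg_of_pos (re_two_cpow_sub_one_neg hσ)
    (Complex.normSq_pos.2 (two_cpow_sub_one_ne_zero hσ))

/-- Away from `s = 1` the tree's `dirichletEta` is the product `(1 − 2^{1−s}) ζ(s)` near `s`. [folklore] -/
private theorem dirichletEta_eventuallyEq {s : ℂ} (hs1 : s ≠ 1) :
    dirichletEta =ᶠ[𝓝 s] fun z => (1 - (2 : ℂ) ^ (1 - z)) * riemannZeta z := by
  filter_upwards [isOpen_ne.mem_nhds hs1] with z hz
  rw [dirichletEta, if_neg hz]

/-- The factor `1 − 2^{1−z}` has derivative `2^{1−s} log 2` at `s`. [folklore] -/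
private theorem hasDerivAt_one_sub_two_cpow (s : ℂ) :
    HasDerivAt (fun z : ℂ => 1 - (2 : ℂ) ^ (1 - z)) ((2 : ℂ) ^ (1 - s) * Complex.log 2) s := by
  have h1 : HasDerivAt (fun z : ℂ => 1 - z) (-1) s := (hasDerivAt_id s).const_sub 1
  have h2 := h1.const_cpow (c := (2 : ℂ)) (Or.inl two_ne_zero)
  have h3 := h2.const_sub (1 : ℂ)
  rw [mul_neg_one, neg_neg] at h3
  exact h3

/-- `η` is differentiable at every `s ≠ 1`. [folklore] -/
private theorem differentiableAt_dirichletEta {s : ℂ} (hs1 : s ≠ 1) : DifferentiableAt ℂ dirichletEta s :=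
  (((hasDerivAt_one_sub_two_cpow s).differentiableAt).mul (differentiableAt_riemannZeta hs1)).congr_of_eventuallyEq
    (dirichletEta_eventuallyEq hs1)

/-- **The logarithmic derivative of `η`** (proof of (A)): "`η′(s)/η(s) = 2^{1−s} log 2/(1 − 2^{1−s}) + ζ′(s)/ζ(s)
= log 2/(2^{s−1} − 1) + ζ′(s)/ζ(s)`", for `σ < 1`, `ζ(s) ≠ 0`.
[cite: MatiyasevichSaidakZvengrowski2014, §3 proof of (A)] -/
theorem logDeriv_dirichletEta_eq {s : ℂ} (hσ : s.re < 1) (hζ : riemannZeta s ≠ 0) :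
    logDeriv dirichletEta s = (Real.log 2 : ℂ) / ((2 : ℂ) ^ (s - 1) - 1) + logDeriv riemannZeta s := by
  have hs1 : s ≠ 1 := by
    intro h; rw [h, one_re] at hσ; exact lt_irrefl _ hσ
  have hkey : (2 : ℂ) ^ (1 - s) * (2 : ℂ) ^ (s - 1) = 1 := by
    rw [← Complex.cpow_add _ _ two_ne_zero, show (1 - s) + (s - 1) = 0 by ring, Complex.cpow_zero]
  have hne := two_cpow_sub_one_ne_zero hσ
  have hg0 : (1 : ℂ) - (2 : ℂ) ^ (1 - s) ≠ 0 := by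
    intro h0
    apply hne
    linear_combination hkey + ((2 : ℂ) ^ (s - 1)) * h0
  have hlog2 : (Real.log 2 : ℂ) = Complex.log 2 := by
    rw [show (2 : ℂ) = ((2 : ℝ) : ℂ) by norm_num, ← Complex.ofReal_log zero_le_two]
  have hlogg : logDeriv (fun z : ℂ => 1 - (2 : ℂ) ^ (1 - z)) s = (Real.log 2 : ℂ) / ((2 : ℂ) ^ (s - 1) - 1) := by
    rw [logDeriv_apply, (hasDerivAt_one_sub_two_cpow s).deriv, hlog2, div_eq_div_iff hg0 hne]
    linear_combination (Complex.log 2) * hkey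
  rw [logDeriv_congr_of_eventuallyEq (dirichletEta_eventuallyEq hs1),
    logDeriv_mul (f := fun z : ℂ => 1 - (2 : ℂ) ^ (1 - z)) (g := riemannZeta) s hg0 hζ
      (hasDerivAt_one_sub_two_cpow s).differentiableAt (differentiableAt_riemannZeta hs1), hlogg]

end MatiyasevichSaidakZvengrowski2014

/-- **Matiyasevich–Saidak–Zvengrowski 2014, Theorem 1.3 (A)**: "`Re(η′(s)/η(s)) < Re(ζ′(s)/ζ(s))`"
— as its proof gives it, "indeed for `σ < 1`", at every `s` with `ζ(s) ≠ 0`; `η` is the tree's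
`dirichletEta`. [cite: MatiyasevichSaidakZvengrowski2014, Thm 1.3 (A)] -/
theorem MatiyasevichSaidakZvengrowski2014_thm1_3A {s : ℂ} (hσ : s.re < 1) (hζ : riemannZeta s ≠ 0) :
    (logDeriv dirichletEta s).re < (logDeriv riemannZeta s).re := by
  rw [MatiyasevichSaidakZvengrowski2014.logDeriv_dirichletEta_eq hσ hζ, add_re]
  have h := MatiyasevichSaidakZvengrowski2014.re_one_div_two_cpow_sub_one_neg hσ
  have heq : ((Real.log 2 : ℂ) / ((2 : ℂ) ^ (s - 1) - 1)).re =
      Real.log 2 * (1 / ((2 : ℂ) ^ (s - 1) - 1)).re := by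
    rw [div_eq_mul_one_div, Complex.re_ofReal_mul]
  rw [heq]
  have hl : 0 < Real.log 2 := Real.log_pos one_lt_two
  have := mul_neg_of_pos_of_neg hl h
  linarith

namespace MatiyasevichSaidakZvengrowski2014

/-- `Re η′/η(s) < 0` for `σ ≤ 0`, `|t| ≥ 8` (by (A) and the `ζ`-statement).
[cite: MatiyasevichSaidakZvengrowski2014, §3 proof of Thm 3.4] -/
theorem re_logDeriv_dirichletEta_neg_of_re_le_zero {s : ℂ} (hs : s.re ≤ 0) (ht : 8 ≤ |s.im|) :
    (logDeriv dirichletEta s).re < 0 := by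
  have him : s.im ≠ 0 := by
    intro h; rw [h, abs_zero] at ht; linarith
  have h1 := MatiyasevichSaidakZvengrowski2014_thm1_3A (by linarith)
    (riemannZeta_ne_zero_of_re_le_zero hs him)
  linarith [re_logDeriv_riemannZeta_neg_of_re_le_zero hs ht]

/-- Under RH, `Re η′/η(s) < 0` for `σ < 1/2`, `|t| ≥ 8`. [cite: MatiyasevichSaidakZvengrowski2014, §3 proof of Thm 3.4] -/
theorem re_logDeriv_dirichletEta_neg_of_RH (hRH : RiemannHypothesis) {s : ℂ} (hs : s.re < 1 / 2)
    (ht : 8 ≤ |s.im|) : (logDeriv dirichletEta s).re < 0 := by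
  have him : s.im ≠ 0 := by
    intro h; rw [h, abs_zero] at ht; linarith
  have h1 := MatiyasevichSaidakZvengrowski2014_thm1_3A (by linarith) (riemannZeta_ne_zero_of_RH hRH hs him)
  linarith [re_logDeriv_riemannZeta_neg_of_RH hRH hs ht]

/-- `η` is differentiable at the points of a horizontal line `Im s = t ≠ 0`. [folklore] -/
private theorem differentiableAt_dirichletEta_horizontal {t : ℝ} (ht : t ≠ 0) (σ : ℝ) :
    DifferentiableAt ℂ dirichletEta ((σ : ℂ) + t * I) := by
  refine differentiableAt_dirichletEta fun h ↦ ?_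
  have := congrArg Complex.im h
  simp at this
  exact ht this

end MatiyasevichSaidakZvengrowski2014

/-- **Theorem 1.4 (= 3.4) for `η`, unconditional clause**: for every `|t| ≥ 8`, `σ ↦ |η(σ + it)|` is strictly
decreasing on `σ ≤ 0`. [cite: MatiyasevichSaidakZvengrowski2014, Thm 1.4] -/
theorem MatiyasevichSaidakZvengrowski2014_thm1_4_eta {t : ℝ} (ht : 8 ≤ |t|) :
    StrictAntiOn (fun σ : ℝ => ‖dirichletEta ((σ : ℂ) + t * I)‖) (Iic 0) := by
  have ht0 : t ≠ 0 := by
    intro h; rw [h, abs_zero] at ht; linarith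
  refine norm_strictAntiOn_of_re_logDeriv_neg (convex_Iic 0) (differentiableAt_dirichletEta_horizontal ht0)
    fun σ hσ ↦ ?_
  rw [interior_Iic] at hσ
  exact re_logDeriv_dirichletEta_neg_of_re_le_zero (by simpa using hσ.le) (by simpa using ht)

/-- Under RH, for every `|t| ≥ 8`, `σ ↦ |η(σ + it)|` is strictly decreasing on `σ ≤ 1/2`.
[cite: MatiyasevichSaidakZvengrowski2014, Thm 1.4] -/
theorem norm_dirichletEta_strictAntiOn_Iic_half_of_RH (hRH : RiemannHypothesis) {t : ℝ} (ht : 8 ≤ |t|) :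
    StrictAntiOn (fun σ : ℝ => ‖dirichletEta ((σ : ℂ) + t * I)‖) (Iic (1 / 2)) := by
  have ht0 : t ≠ 0 := by
    intro h; rw [h, abs_zero] at ht; linarith
  refine norm_strictAntiOn_of_re_logDeriv_neg (convex_Iic _) (differentiableAt_dirichletEta_horizontal ht0)
    fun σ hσ ↦ ?_
  rw [interior_Iic] at hσ
  exact re_logDeriv_dirichletEta_neg_of_RH hRH (by simpa using hσ) (by simpa using ht)

/-- Converse clause for `η`: strict decrease of `σ ↦ |η(σ + it)|` on `0 ≤ σ ≤ 1/2` for every `|t| ≥ 8`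
gives RH (a zero `ρ` of `ζ` with `0 < Re ρ < 1/2` is a zero of `η`, `dirichletEta_eq_zero_iff`).
[cite: MatiyasevichSaidakZvengrowski2014, Thm 1.4 and proof of Thm 3.4] -/
theorem riemannHypothesis_of_norm_dirichletEta_strictAntiOn_Icc
    (h : ∀ t : ℝ, 8 ≤ |t| → StrictAntiOn (fun σ : ℝ => ‖dirichletEta ((σ : ℂ) + t * I)‖) (Icc 0 (1 / 2))) :
    RiemannHypothesis := by
  rw [show RiemannHypothesis ↔ RiemannHypothesisStrip from riemannHypothesis_iff_strip_holds]
  have key : ∀ ρ : ℂ, riemannZeta ρ = 0 → 0 < ρ.re → ρ.re < 1 / 2 → False := by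
    intro ρ hζ h0 h1
    have hγ : 8 ≤ |ρ.im| := eight_le_abs_im_of_zero hζ h0 (by linarith)
    have hη : dirichletEta ρ = 0 := (dirichletEta_eq_zero_iff (by linarith)).2 hζ
    have hlt := h ρ.im hγ ⟨h0.le, h1.le⟩ ⟨by norm_num, le_rfl⟩ h1
    have hρ : ((ρ.re : ℂ) + ρ.im * I) = ρ := Complex.ext (by simp) (by simp)
    simp only [hρ, hη, norm_zero] at hlt
    exact absurd hlt (not_lt.2 (norm_nonneg _))
  intro s hζ h0 h1
  by_contra hne
  rcases lt_or_gt_of_ne hne with hlt | hgt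
  · exact key s hζ h0 hlt
  · exact key (1 - s) (GeneralizedRH.riemannZeta_one_sub_eq_zero hζ h0 h1)
      (by simp only [sub_re, one_re]; linarith) (by simp only [sub_re, one_re]; linarith)

/-- **Theorem 1.4 (= 3.4) for `η`, second clause**: `RH ⟺` for every `|t| ≥ 8`, `σ ↦ |η(σ + it)|` is
strictly decreasing on `σ ≤ 1/2`. RH-EQUIVALENT. [cite: MatiyasevichSaidakZvengrowski2014, Thm 1.4] -/
theorem riemannHypothesis_iff_norm_dirichletEta_strictAntiOn :
    RiemannHypothesis ↔
      ∀ t : ℝ, 8 ≤ |t| → StrictAntiOn (fun σ : ℝ => ‖dirichletEta ((σ : ℂ) + t * I)‖) (Iic (1 / 2)) := by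
  refine ⟨fun hRH t ht ↦ norm_dirichletEta_strictAntiOn_Iic_half_of_RH hRH ht, fun h ↦
    riemannHypothesis_of_norm_dirichletEta_strictAntiOn_Icc fun t ht ↦ (h t ht).mono ?_⟩
  exact fun σ hσ ↦ hσ.2

/-! ## The `ξ`-clauses with the printed closed endpoint (the open-ray forms are Sondow–Dumitrescu's,
`XiModulusMonotone.lean`) -/

/-- **Theorem 1.4 (= 3.4) for `ξ`, unconditional clause** (no restriction on `t`: "`Re(ξ′(s)/ξ(s)) < 0` for
`σ ≤ 0`"): `σ ↦ |ξ(σ + it)|` is strictly decreasing on `σ ≤ 0`. (Open ray `σ < 0`: the tree's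
`SondowDumitrescu2010.norm_riemannXi_strictAntiOn_Iio_zero`.) [cite: MatiyasevichSaidakZvengrowski2014, Thm 1.4] -/
theorem MatiyasevichSaidakZvengrowski2014_thm1_4_xi (t : ℝ) :
    StrictAntiOn (fun σ : ℝ => ‖riemannXi ((σ : ℂ) + t * I)‖) (Iic 0) := by
  refine norm_strictAntiOn_of_re_logDeriv_neg (convex_Iic 0) (fun σ ↦ (differentiable_riemannXi _))
    fun σ hσ ↦ ?_
  rw [interior_Iic] at hσ
  exact re_logDeriv_riemannXi_neg_of_re_le_zero (by simpa using hσ.le)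

/-- **Theorem 1.4 (= 3.4) for `ξ`, second clause** with the closed endpoint: `RH ⟺` for every real `t`,
`σ ↦ |ξ(σ + it)|` is strictly decreasing on `σ ≤ 1/2` (the open-ray form `σ < 1/2` is the tree's
`SondowDumitrescu2010.riemannHypothesis_iff_norm_riemannXi_strictAntiOn`, used for `⟸`). RH-EQUIVALENT.
[cite: MatiyasevichSaidakZvengrowski2014, Thm 1.4] [cite: SondowDumitrescu2010, Cor 1] -/
theorem riemannHypothesis_iff_norm_riemannXi_strictAntiOn_Iic :
    RiemannHypothesis ↔
      ∀ t : ℝ, StrictAntiOn (fun σ : ℝ => ‖riemannXi ((σ : ℂ) + t * I)‖) (Iic (1 / 2)) := by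
  constructor
  · intro hRH t
    refine norm_strictAntiOn_of_re_logDeriv_neg (convex_Iic _) (fun σ ↦ (differentiable_riemannXi _))
      fun σ hσ ↦ ?_
    rw [interior_Iic] at hσ
    exact re_logDeriv_riemannXi_neg_of_RH hRH (by simpa using hσ)
  · intro h
    exact SondowDumitrescu2010.riemannHypothesis_iff_norm_riemannXi_strictAntiOn.2
      fun t ↦ (h t).mono Iio_subset_Iic_self

end Literature.NumberTheory.LFunctions
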